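import Literature.Barriers.ABC.BakerMethodBounds
import Literature.NumberTheory.DiophantineGeometry.AbcWave0QualityFormProofs
import HarnessLib
import HarnessLib.Audit

/-!
# The Lagarias–Soundararajan `xyz` conjecture (smooth solutions of `a + b = c`)

Topic `NumberTheory/DiophantineGeometry` (the `AbcWave0` neighbourhood). CONJECTURE RECORD requested
by route `ABC/BelyiDegreeSmooth`, whose target `XYZLowerBound` (stmt-ABC-2244) is the positivity
half of the conjecture; `xyzLowerHalf_iff` proves that the record and the route's sentence agree
verbatim.

## Source

J. C. Lagarias, K. Soundararajan, *Smooth solutions to the abc equation: the xyz conjecture*,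
J. Théor. Nombres Bordeaux 23 (2011) 209–234 [LagariasSoundararajan2011] (= arXiv:0911.4147, whose
numbering we follow; READ §1–§2). For a primitive solution of `X + Y = Z` put
`H = max(|X|, |Y|, |Z|)` (height, (1.1)) and `S = max{p : p ∣ XYZ}` (smoothness, (1.4)); the
smoothness exponent of a solution is `κ₀(X, Y, Z) = log S / log log H` (1.5) and
`κ₀ := liminf_{H → ∞} κ₀(X, Y, Z)` over primitive solutions (1.6), a priori `0 ≤ κ₀ ≤ +∞`.

* **xyz conjecture (weak form-1)** (§1.1): there is `κ₀ > 0` such that (a) for each `ε > 0` only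
  finitely many primitive solutions have `S < (log H)^{κ₀ - ε}`, and (b) for each `ε > 0`
  infinitely many have `S < (log H)^{κ₀ + ε}`.
* **weak form-2** (§1.1): `κ₀` is positive and finite (⟺ weak form-1, `xyzConjecture_iff_exists_exponent`);
  **strong form** (§1.2): `κ₀ = 3/2`.
* Thm. 1.1 / 2.1 (weak abc with exponent `κ₁` ⟹ (a) at `κ₁`, so strong abc ⟹ `κ₀ ≥ 1`), Thm. 2.2
  (via Stewart–Yu: finitely many primitive solutions with `S ≤ (3 - ε) log log H`) and Thm. 1.3
  (weak abc + [GRH ⟹ (b) at `8`] ⟹ weak xyz) are PROVED in the sibling file `XYZConjectureABC.lean`;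
  Thm. 1.2 itself (GRH ⟹ (b) at `8`, proved in the authors' Proc. LMS 104 (2012) paper by the
  circle method) is NOT vendored (no item uses it as a hypothesis; D-0026).
* STATUS (2016): the finiteness half `κ₀ < ∞` is a THEOREM — Harper, Compositio Math. 152 (2016)
  [Harper2016], Cor. 1 with the remark after it ("xyz-smoothness exponent is at most `K`") — recorded
  as the NAMED FACT `XYZUpperHalf`; open are the positivity half `κ₀ > 0` (`XYZLowerHalf`, to which the
  weak form-2 is then equivalent, `xyzConjecture_iff_xyzLowerHalf`) and the strong form `κ₀ = 3/2`.

## Rendering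

Primitive solutions are the tree's abc triples `IsABCTriple a b c` (`H = c`; a primitive solution of
`X + Y + Z = 0` is such a triple up to permutation and signs, finite-to-one). `S(a, b, c)` is
`Literature.Barriers.ABC.largestPrimeFactor (a * b * c)`. Properties (a), (b) at a real `κ` are the
predicates `XYZ.ExponentGE κ` ("`κ₀ ≥ κ`"), `XYZ.ExponentLE κ` ("`κ₀ ≤ κ`") — the `liminf` statements
of (1.6) since finitely many triples have bounded height (`finite_isABCTriple_of_le_real`,
`mem_smoothTriples_iff_exponent_lt`); no `Filter.liminf` is introduced. The transcription includes
`(1, 1, 2)`, the only triple with `log H < 1`, so monotonicity in `κ` holds "up to `(1, 1, 2)`"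
(`smoothTriples_subset_insert`). NOT here: weak form-3 (§1.5), the `xyz`-quality (1.8), §1.3, and
Pasten's record `𝒫(abc) ≫ (log₂ c)²/log₃ c` [Pasten2024, Cor. 1.5] (`pasten2024_thm_1_4_2`).

## References

* [LagariasSoundararajan2011] JTNB 23 (2011) 209–234, doi:10.5802/jtnb.757, arXiv:0911.4147 — §1.1–1.4, §2.
* [Harper2016] A. J. Harper, Compositio Math. 152 (2016) 1121–1158, Cor. 1 and §1 (arXiv:1408.1662).
* [StewartYu2001] Duke Math. J. 108 (2001), Thm. 1; [Pasten2024] Invent. Math. 236 (2024), Cor. 1.5.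
-/

noncomputable section

open Real
open Literature.Barriers.ABC (largestPrimeFactor)

namespace Literature.NumberTheory.DiophantineGeometry

variable {a b c : ℕ}

/-! ### Finitely many abc triples of bounded height -/

/-- Only finitely many abc triples have height `c ≤ X` (`a, b < c ≤ ⌈X⌉`; the `ℕ`-threshold form is
`Literature.Barriers.ABC.finite_isABCTriple_le`, in a file too heavy to import here). [folklore] -/
theorem finite_isABCTriple_of_le_real (X : ℝ) :
    {t : ℕ × ℕ × ℕ | IsABCTriple t.1 t.2.1 t.2.2 ∧ (t.2.2 : ℝ) ≤ X}.Finite := by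
  refine (Finset.finite_toSet (Finset.range (⌈X⌉₊ + 1) ×ˢ (Finset.range (⌈X⌉₊ + 1) ×ˢ
    Finset.range (⌈X⌉₊ + 1)))).subset ?_
  rintro t ⟨⟨ha, hb, habc, -⟩, hc⟩
  have hcN : t.2.2 ≤ ⌈X⌉₊ := Nat.cast_le.mp (hc.trans (Nat.le_ceil X))
  simp only [Finset.coe_product, Finset.coe_range, Set.mem_prod, Set.mem_Iio]
  omega

/-- An abc triple with `c ≤ 2` is `(1, 1, 2)`. [folklore] -/
theorem IsABCTriple.eq_of_le_two (h : IsABCTriple a b c) (hc : c ≤ 2) : a = 1 ∧ b = 1 ∧ c = 2 := by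
  obtain ⟨ha, hb, habc, -⟩ := h
  omega

/-- `log c > 1` for `c ≥ 3` (`e < 3`). [folklore] -/
theorem one_lt_log_of_three_le {c : ℕ} (hc : 3 ≤ c) : 1 < Real.log c := by
  rw [Real.lt_log_iff_exp_lt (by positivity)]
  calc Real.exp 1 < 2.7182818286 := Real.exp_one_lt_d9
    _ < 3 := by norm_num
    _ ≤ (c : ℝ) := by exact_mod_cast hc

namespace XYZ

/-! ### Smoothness `S(a, b, c)` and the smoothness exponent -/

/-- The **smoothness** `S(a, b, c) = max{p : p ∣ abc}` of a triple, the largest prime factor of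
`abc` [LagariasSoundararajan2011, (1.4)]; rendered by the tree's `largestPrimeFactor` (junk value
`1` when `abc ≤ 1`, which no abc triple attains). [cite: LagariasSoundararajan2011, §1.1 (1.4)] -/
def smoothness (a b c : ℕ) : ℕ :=
  largestPrimeFactor (a * b * c)

/-- Every prime factor of `abc` is at most `S(a, b, c)`. [folklore] -/
theorem le_smoothness_of_mem_primeFactors {p : ℕ} (hp : p ∈ (a * b * c).primeFactors) :
    p ≤ smoothness a b c := by
  rw [smoothness, Literature.Barriers.ABC.largestPrimeFactor_def]
  exact le_max_of_le_right (Finset.le_sup (f := id) hp)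

/-- For an abc triple, `S(a, b, c)` is a prime factor of `abc` (as `abc ≥ 2`). [folklore] -/
theorem smoothness_mem_primeFactors (h : IsABCTriple a b c) :
    smoothness a b c ∈ (a * b * c).primeFactors := by
  obtain ⟨ha, hb, habc, -⟩ := h
  have h1 : 1 < a * b * c := by
    have hab : 1 ≤ a * b := Nat.mul_pos ha hb
    calc 1 < c := by omega
      _ = 1 * c := (one_mul c).symm
      _ ≤ a * b * c := Nat.mul_le_mul_right c hab
  obtain ⟨q, hq, hsup⟩ :=
    Finset.exists_mem_eq_sup _ (Nat.nonempty_primeFactors.mpr h1) (id : ℕ → ℕ)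
  have hq2 : 2 ≤ q := (Nat.prime_of_mem_primeFactors hq).two_le
  rw [smoothness, Literature.Barriers.ABC.largestPrimeFactor_def, hsup, id,
    max_eq_right (by omega)]
  exact hq

/-- For an abc triple, `S(a, b, c) ≥ 2` (it is a prime). [folklore] -/
theorem two_le_smoothness (h : IsABCTriple a b c) : 2 ≤ smoothness a b c :=
  (Nat.prime_of_mem_primeFactors (smoothness_mem_primeFactors h)).two_le

/-- The **smoothness exponent** `κ₀(a, b, c) = log S(a, b, c) / log log H` of a triple, `H = c`
[LagariasSoundararajan2011, (1.5)] (junk `log`-values for `c ≤ 2`, irrelevant asymptotically).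
[cite: LagariasSoundararajan2011, §1.1 (1.5)] -/
def exponent (a b c : ℕ) : ℝ :=
  Real.log (smoothness a b c) / Real.log (Real.log c)

/-! ### The sets `{S < (log H)^κ}` and properties (a), (b) -/

/-- The set of abc triples of smoothness `S(a, b, c) < (log c)^κ` (real exponent `κ`), the set
whose finiteness / infinitude is asserted in properties (a) / (b) of the xyz conjecture.
[cite: LagariasSoundararajan2011, §1.1 (weak form-1)] -/
def smoothTriples (κ : ℝ) : Set (ℕ × ℕ × ℕ) :=
  {t | IsABCTriple t.1 t.2.1 t.2.2 ∧ (smoothness t.1 t.2.1 t.2.2 : ℝ) < Real.log t.2.2 ^ κ}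

/-- Monotonicity in `κ` up to the triple `(1, 1, 2)` (the only abc triple with `log c < 1`):
for `κ ≤ κ'`, `{S < (log c)^κ} ⊆ {S < (log c)^κ'} ∪ {(1, 1, 2)}`. [folklore] -/
theorem smoothTriples_subset_insert {κ κ' : ℝ} (h : κ ≤ κ') :
    smoothTriples κ ⊆ insert (1, 1, 2) (smoothTriples κ') := by
  rintro ⟨a, b, c⟩ ⟨ht, hlt⟩
  dsimp only at ht hlt
  by_cases hc : c ≤ 2
  · obtain ⟨rfl, rfl, rfl⟩ := ht.eq_of_le_two hc
    exact Set.mem_insert _ _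
  · refine Set.mem_insert_of_mem _ ⟨ht, hlt.trans_le ?_⟩
    exact Real.rpow_le_rpow_of_exponent_le (one_lt_log_of_three_le (by omega)).le h

/-- Finiteness of `{S < (log c)^κ}` is downward monotone in `κ`. [folklore] -/
theorem finite_smoothTriples_mono {κ κ' : ℝ} (h : κ ≤ κ') (hf : (smoothTriples κ').Finite) :
    (smoothTriples κ).Finite :=
  (hf.insert (1, 1, 2)).subset (smoothTriples_subset_insert h)

/-- Infinitude of `{S < (log c)^κ}` is upward monotone in `κ`. [folklore] -/
theorem infinite_smoothTriples_mono {κ κ' : ℝ} (h : κ ≤ κ') (hi : (smoothTriples κ).Infinite) :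
    (smoothTriples κ').Infinite :=
  fun hf => hi (finite_smoothTriples_mono h hf)

/-- **The two renderings agree**: for an abc triple with `c ≥ 3` (so that `log log c > 0`),
`S(a, b, c) < (log c)^κ` iff the smoothness exponent (1.5) satisfies `κ₀(a, b, c) < κ`; hence
properties (a)/(b) below are the `liminf` statements of the source about `κ₀(X, Y, Z)`.
[cite: LagariasSoundararajan2011, §1.1 (1.5)–(1.6)] -/
theorem mem_smoothTriples_iff_exponent_lt {κ : ℝ} {t : ℕ × ℕ × ℕ} (ht : IsABCTriple t.1 t.2.1 t.2.2)
    (hc : 3 ≤ t.2.2) : t ∈ smoothTriples κ ↔ exponent t.1 t.2.1 t.2.2 < κ := by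
  have hlog1 : 1 < Real.log t.2.2 := one_lt_log_of_three_le hc
  have hlog0 : 0 < Real.log t.2.2 := zero_lt_one.trans hlog1
  have hll : 0 < Real.log (Real.log t.2.2) := Real.log_pos hlog1
  have hS : (0 : ℝ) < smoothness t.1 t.2.1 t.2.2 := by
    exact_mod_cast lt_of_lt_of_le zero_lt_two (two_le_smoothness ht)
  simp only [smoothTriples, Set.mem_setOf_eq, exponent]
  rw [div_lt_iff₀ hll, ← Real.log_rpow hlog0, Real.log_lt_log_iff hS (Real.rpow_pos_of_pos hlog0 κ)]
  exact ⟨fun h => h.2, fun h => ⟨ht, h⟩⟩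

/-- **Property (a) at `κ`** of the xyz conjecture, i.e. "`κ₀ ≥ κ`" for the smoothness exponent
(1.6): for each `ε > 0` only finitely many abc triples have `S(a, b, c) < (log c)^{κ - ε}`.
[cite: LagariasSoundararajan2011, §1.1 (weak form-1 (a))] -/
def ExponentGE (κ : ℝ) : Prop :=
  ∀ ε : ℝ, 0 < ε → (smoothTriples (κ - ε)).Finite

/-- **Property (b) at `κ`** of the xyz conjecture, i.e. "`κ₀ ≤ κ`": for each `ε > 0` infinitely
many abc triples have `S(a, b, c) < (log c)^{κ + ε}`.
[cite: LagariasSoundararajan2011, §1.1 (weak form-1 (b))] -/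
def ExponentLE (κ : ℝ) : Prop :=
  ∀ ε : ℝ, 0 < ε → (smoothTriples (κ + ε)).Infinite

/-- Properties (a) at `κ` and (b) at `κ'` force `κ ≤ κ'` ("(a) and (b) are mutually exclusive",
§1.1): the constant `κ₀` of weak form-1 is unique. [cite: LagariasSoundararajan2011, §1.1] -/
theorem ExponentGE.le_of_exponentLE {κ κ' : ℝ} (ha : ExponentGE κ) (hb : ExponentLE κ') :
    κ ≤ κ' := by
  by_contra hlt
  push Not at hlt
  have hε : 0 < (κ - κ') / 2 := by linarith
  have h1 := ha _ hε
  have h2 := hb _ hε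
  rw [show κ' + (κ - κ') / 2 = κ - (κ - κ') / 2 by ring] at h2
  exact h2 h1

end XYZ

/-! ### The conjecture records -/

/-- OPEN CONJECTURE — **xyz conjecture, positivity half `κ₀ > 0`** [LagariasSoundararajan2011,
§1.1, weak form-2, first half; = property (a) for some `κ₀ > 0`]: there is `κ > 0` such that only
finitely many abc triples have largest prime factor `S(a, b, c) < (log c)^κ`. Open (§1.6: "We are
not aware of any approach that might yield a positive unconditional lower bound for `κ₀`"); implied
by abc (Thm. 1.1, `XYZConjectureABC.lean`); records: `S > (3 - ε) log log c` (Thm. 2.2, Stewart–Yu),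
`S ≫ (log₂ c)²/log₃ c` [Pasten2024, Cor. 1.5]. Verbatim the target `XYZLowerBound` of route
`ABC/BelyiDegreeSmooth` (`xyzLowerHalf_iff`). Use only as a hypothesis or a conclusion.
[cite: LagariasSoundararajan2011, §1.1 (xyz conjecture, weak form-2)] [status: open] -/
@[conjecture] def XYZLowerHalf : Prop :=
  ∃ κ : ℝ, 0 < κ ∧ (XYZ.smoothTriples κ).Finite

/-- NAMED FACT — **the finiteness half `κ₀ < ∞` of the xyz conjecture is a theorem (Harper 2016)**.
Lagarias–Soundararajan's property (b) for some `κ` [LagariasSoundararajan2011, §1.1, second half of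
weak form-2]: there is `κ` such that infinitely many abc triples have `S(a, b, c) < (log c)^κ`.
Under GRH with any `κ > 8` (loc. cit., Thm. 1.2, Proc. LMS 104 (2012)); UNCONDITIONALLY by A. J.
Harper, Compositio Math. 152 (2016), Cor. 1: "There exists a large absolute constant `K > 0` such
that, for any large `logᴷ x ≤ y ≤ x`, `#{(a,b,c) ∈ 𝒮(y)³ : a, b, c ≤ x, a + b = c} = Ψ(x,y)³/(2x) ·
(1 + O(log(u+1)/log y))`", with the remark following it (§1): "Corollary 1 now proves unconditionally
that Lagarias and Soundararajan's 'xyz-smoothness exponent' is at most `K`, and in particular is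
finite" (footnote: coprimality by "a simple inclusion-exclusion argument as in §8 of their paper").
Vendored in the qualitative form `∃ κ` (Harper's `K` is an unspecified absolute constant);
equivalently `∃ K, XYZ.ExponentLE K` (`xyzUpperHalf_iff_exists_exponentLE`). Not discharged here
(circle method with Harper's restriction estimates).
[cite: Harper2016, Cor. 1 and the remark following it (§1, "xyz-smoothness exponent is at most K")] [cite: LagariasSoundararajan2011, §1.1 (weak form-2, second half) and Thm. 1.2] -/
def XYZUpperHalf : Prop :=
  ∃ κ : ℝ, (XYZ.smoothTriples κ).Infinite

/-- OPEN CONJECTURE — **the xyz conjecture (weak form-2)** [LagariasSoundararajan2011, §1.1]: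
"The XYZ-smoothness exponent `κ₀` is positive and finite", i.e. both halves. Equivalent to weak
form-1 (`xyzConjecture_iff_exists_exponent`); follows from weak abc + GRH (Thm. 1.3, alphabet
soup, `XYZConjectureABC.lean`). Since the finiteness half is Harper's theorem (`XYZUpperHalf`, a
named fact), the conjecture is EQUIVALENT TO ITS POSITIVITY HALF `XYZLowerHalf` given that fact
(`xyzConjecture_iff_xyzLowerHalf`): what is open is `κ₀ > 0` only.
[cite: LagariasSoundararajan2011, §1.1 (weak form-2)] [status: open] -/
@[conjecture] def XYZConjecture : Prop :=
  XYZLowerHalf ∧ XYZUpperHalf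

/-- OPEN CONJECTURE — **the xyz conjecture (strong form)** [LagariasSoundararajan2011, §1.2]: "The
XYZ-smoothness exponent `κ₀ = 3/2`", i.e. (a) and (b) at `3/2`. [cite: LagariasSoundararajan2011, §1.2 (strong form)] [status: open] -/
@[conjecture] def XYZConjectureStrong : Prop :=
  XYZ.ExponentGE (3 / 2) ∧ XYZ.ExponentLE (3 / 2)

/-! ### Elementary relations between the records -/

/-- **Weak form-2 ⟺ weak form-1** [LagariasSoundararajan2011, §1.1: "it suffices to show that
property (a) holds for some `κ₀ > 0` and that property (b) holds for some `κ₀ < ∞` … a unique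
constant `κ₀` exists satisfying both (a) and (b)"]: `κ₀` is the supremum of the `κ` with
`{S < (log c)^κ}` finite. [cite: LagariasSoundararajan2011, §1.1] -/
theorem xyzConjecture_iff_exists_exponent :
    XYZConjecture ↔ ∃ κ₀ : ℝ, 0 < κ₀ ∧ XYZ.ExponentGE κ₀ ∧ XYZ.ExponentLE κ₀ := by
  constructor
  · rintro ⟨⟨κ₁, hκ₁, hF⟩, ⟨κ₂, hI⟩⟩
    set A : Set ℝ := {κ | (XYZ.smoothTriples κ).Finite} with hA
    have hne : A.Nonempty := ⟨κ₁, hF⟩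
    have hbdd : BddAbove A := by
      refine ⟨κ₂, fun κ hκ => ?_⟩
      by_contra hlt
      push Not at hlt
      exact hI (XYZ.finite_smoothTriples_mono hlt.le hκ)
    refine ⟨sSup A, hκ₁.trans_le (le_csSup hbdd hF), fun ε hε => ?_, fun ε hε => ?_⟩
    · obtain ⟨κ, hκA, hlt⟩ := exists_lt_of_lt_csSup hne (sub_lt_self (sSup A) hε)
      exact XYZ.finite_smoothTriples_mono hlt.le hκA
    · intro hfin
      have := le_csSup hbdd (show sSup A + ε ∈ A from hfin)
      linarith
  · rintro ⟨κ₀, hκ₀, ha, hb⟩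
    refine ⟨⟨κ₀ / 2, half_pos hκ₀, ?_⟩, ⟨κ₀ + 1, hb 1 one_pos⟩⟩
    have h := ha (κ₀ / 2) (half_pos hκ₀)
    rwa [show κ₀ - κ₀ / 2 = κ₀ / 2 by ring] at h

/-- The strong form implies the weak form. [cite: LagariasSoundararajan2011, §1.1–1.2] -/
theorem XYZConjectureStrong.xyzConjecture (h : XYZConjectureStrong) : XYZConjecture :=
  xyzConjecture_iff_exists_exponent.mpr ⟨3 / 2, by norm_num, h.1, h.2⟩

/-- Property (a) at some `κ > 0` is the positivity half. [cite: LagariasSoundararajan2011, §1.1] -/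
theorem XYZ.ExponentGE.xyzLowerHalf {κ : ℝ} (h : XYZ.ExponentGE κ) (hκ : 0 < κ) : XYZLowerHalf :=
  ⟨κ / 2, half_pos hκ, by simpa [show κ - κ / 2 = κ / 2 by ring] using h (κ / 2) (half_pos hκ)⟩

/-- Property (b) at any `κ` is the finiteness half. [cite: LagariasSoundararajan2011, §1.1] -/
theorem XYZ.ExponentLE.xyzUpperHalf {κ : ℝ} (h : XYZ.ExponentLE κ) : XYZUpperHalf :=
  ⟨κ + 1, h 1 one_pos⟩

/-- The finiteness half is property (b) at some `κ` (Harper's "`κ₀ ≤ K`"). [cite: Harper2016, §1 (remark after Cor. 1)] -/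
theorem xyzUpperHalf_iff_exists_exponentLE : XYZUpperHalf ↔ ∃ K : ℝ, XYZ.ExponentLE K :=
  ⟨fun ⟨κ, hκ⟩ => ⟨κ, fun ε hε => XYZ.infinite_smoothTriples_mono (by linarith) hκ⟩,
    fun ⟨_, hK⟩ => hK.xyzUpperHalf⟩

/-- **Given Harper's theorem, the xyz conjecture (weak form-2) is its positivity half.**
Relies on: hypothesis `h` (`XYZUpperHalf`, Harper 2016). [cite: Harper2016, §1 (remark after Cor. 1)] -/
theorem xyzConjecture_iff_xyzLowerHalf (h : XYZUpperHalf) : XYZConjecture ↔ XYZLowerHalf :=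
  ⟨fun hc => hc.1, fun hl => ⟨hl, h⟩⟩

/-- **The positivity half is the route sentence "`log c ≤ C · P^K`"** (verbatim
`Summit.ABC.ABC.Theses.BelyiDegreeSmooth.XYZLowerBound`): (→) outside the finite exceptional set,
`S ≥ (log c)^κ` gives `log c ≤ S^{1/κ} ≤ P^⌈1/κ⌉`, and the exceptions have bounded `c`; (←)
`S < (log c)^κ`, `κ = 1/(2K+1)`, and `log c ≤ C S^K` give `log c ≤ C (log c)^{1/2}`, `c ≤ exp(C²)`.
[cite: LagariasSoundararajan2011, §1.1 (weak form-2)] -/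
theorem xyzLowerHalf_iff :
    XYZLowerHalf ↔ ∃ (K : ℕ) (C : ℝ), ∀ a b c : ℕ, IsABCTriple a b c → ∀ P : ℕ,
      (∀ p ∈ (a * b * c).primeFactors, p ≤ P) → Real.log (c : ℝ) ≤ C * (P : ℝ) ^ K := by
  constructor
  · rintro ⟨κ, hκ, hF⟩
    -- `N` bounds `c` over the finite exceptional set
    obtain ⟨N, hN⟩ : ∃ N : ℕ, ∀ t ∈ XYZ.smoothTriples κ, t.2.2 ≤ N := by
      obtain ⟨N, hN⟩ := (hF.image fun t => t.2.2).bddAbove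
      exact ⟨N, fun t ht => hN (Set.mem_image_of_mem _ ht)⟩
    refine ⟨⌈1 / κ⌉₊, max 1 (Real.log N), fun a b c ht P hP => ?_⟩
    have hc2 : 2 ≤ c := ht.two_le
    have hc0 : (0 : ℝ) < c := by exact_mod_cast (lt_of_lt_of_le zero_lt_two hc2)
    have hP2 : 2 ≤ P := (XYZ.two_le_smoothness ht).trans (hP _ (XYZ.smoothness_mem_primeFactors ht))
    have hP1n : 1 ≤ P := le_trans one_le_two hP2
    have hP1 : (1 : ℝ) ≤ P := by exact_mod_cast hP1n
    have hPK : (1 : ℝ) ≤ (P : ℝ) ^ ⌈1 / κ⌉₊ := one_le_pow₀ hP1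
    have hC1 : (1 : ℝ) ≤ max 1 (Real.log N) := le_max_left _ _
    by_cases hmem : ((a, b, c) : ℕ × ℕ × ℕ) ∈ XYZ.smoothTriples κ
    · have hcN : c ≤ N := hN _ hmem
      have hN0 : (0 : ℝ) < N := hc0.trans_le (by exact_mod_cast hcN)
      calc Real.log c ≤ Real.log N := Real.log_le_log hc0 (by exact_mod_cast hcN)
        _ ≤ max 1 (Real.log N) := le_max_right _ _
        _ = max 1 (Real.log N) * 1 := (mul_one _).symm
        _ ≤ max 1 (Real.log N) * (P : ℝ) ^ ⌈1 / κ⌉₊ :=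
          mul_le_mul_of_nonneg_left hPK (by positivity)
    · have hge : Real.log c ^ κ ≤ (XYZ.smoothness a b c : ℝ) := by
        simp only [XYZ.smoothTriples, Set.mem_setOf_eq, not_and, not_lt] at hmem
        exact hmem ht
      have hlog0 : 0 ≤ Real.log c := Real.log_nonneg (by exact_mod_cast le_trans one_le_two hc2)
      have hSP : (XYZ.smoothness a b c : ℝ) ≤ P := by
        exact_mod_cast hP _ (XYZ.smoothness_mem_primeFactors ht)
      have h1 : Real.log c ≤ (P : ℝ) ^ (1 / κ) := by
        calc Real.log c = (Real.log c ^ κ) ^ κ⁻¹ := (Real.rpow_rpow_inv hlog0 hκ.ne').symm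
          _ ≤ (P : ℝ) ^ κ⁻¹ :=
            Real.rpow_le_rpow (by positivity) (hge.trans hSP) (inv_nonneg.mpr hκ.le)
          _ = (P : ℝ) ^ (1 / κ) := by rw [one_div]
      have h2 : (P : ℝ) ^ (1 / κ) ≤ (P : ℝ) ^ ⌈1 / κ⌉₊ := by
        calc (P : ℝ) ^ (1 / κ) ≤ (P : ℝ) ^ ((⌈1 / κ⌉₊ : ℕ) : ℝ) :=
              Real.rpow_le_rpow_of_exponent_le hP1 (Nat.le_ceil _)
          _ = (P : ℝ) ^ ⌈1 / κ⌉₊ := Real.rpow_natCast _ _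
      calc Real.log c ≤ (P : ℝ) ^ ⌈1 / κ⌉₊ := h1.trans h2
        _ = 1 * (P : ℝ) ^ ⌈1 / κ⌉₊ := (one_mul _).symm
        _ ≤ max 1 (Real.log N) * (P : ℝ) ^ ⌈1 / κ⌉₊ := mul_le_mul_of_nonneg_right hC1 (by positivity)
  · rintro ⟨K, C, h⟩
    set κ : ℝ := 1 / (2 * K + 1) with hκdef
    have hκ : 0 < κ := by rw [hκdef]; positivity
    have hκK : κ * K ≤ 1 / 2 := by
      rw [hκdef, div_mul_eq_mul_div, one_mul, div_le_iff₀ (by positivity)]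
      linarith [(Nat.cast_nonneg K : (0 : ℝ) ≤ K)]
    refine ⟨κ, hκ, (finite_isABCTriple_of_le_real (Real.exp (C ^ 2) + 3)).subset ?_⟩
    rintro ⟨a, b, c⟩ ⟨ht, hlt⟩
    dsimp only at ht hlt ⊢
    refine ⟨ht, ?_⟩
    by_contra hbig
    push Not at hbig
    have hc3 : 3 ≤ c := by
      by_contra h3
      push Not at h3
      have : (c : ℝ) ≤ 2 := by exact_mod_cast (show c ≤ 2 by omega)
      linarith [Real.exp_pos (C ^ 2)]
    have hlog1 : 1 < Real.log c := one_lt_log_of_three_le hc3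
    have hlog0 : 0 < Real.log c := zero_lt_one.trans hlog1
    -- `log c ≤ C · S^K ≤ C · (log c)^{κ K} ≤ C · (log c)^{1/2}`
    have hS := h a b c ht (XYZ.smoothness a b c) fun p hp => XYZ.le_smoothness_of_mem_primeFactors hp
    have hS0 : (0 : ℝ) ≤ XYZ.smoothness a b c := Nat.cast_nonneg _
    have hSK : (XYZ.smoothness a b c : ℝ) ^ K ≤ Real.log c ^ (1 / 2 : ℝ) := by
      calc (XYZ.smoothness a b c : ℝ) ^ K ≤ (Real.log c ^ κ) ^ K := pow_le_pow_left₀ hS0 hlt.le K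
        _ = Real.log c ^ (κ * K) := by rw [← Real.rpow_natCast, ← Real.rpow_mul hlog0.le]
        _ ≤ Real.log c ^ (1 / 2 : ℝ) := Real.rpow_le_rpow_of_exponent_le hlog1.le hκK
    have hCpos : 0 < C := by
      by_contra hC
      push Not at hC
      have : Real.log c ≤ 0 :=
        hS.trans (mul_nonpos_of_nonpos_of_nonneg hC (pow_nonneg hS0 K))
      linarith
    have hu0 : 0 < Real.log c ^ (1 / 2 : ℝ) := Real.rpow_pos_of_pos hlog0 _
    have husq : (Real.log c ^ (1 / 2 : ℝ)) ^ 2 = Real.log c := by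
      rw [← Real.rpow_natCast, ← Real.rpow_mul hlog0.le]; norm_num
    have hule : Real.log c ^ (1 / 2 : ℝ) ≤ C := by
      have h1 : Real.log c ≤ C * Real.log c ^ (1 / 2 : ℝ) :=
        hS.trans (mul_le_mul_of_nonneg_left hSK hCpos.le)
      have h1' : Real.log c ^ (1 / 2 : ℝ) * Real.log c ^ (1 / 2 : ℝ) ≤
          C * Real.log c ^ (1 / 2 : ℝ) := by
        rw [← sq, husq]; exact h1
      exact le_of_mul_le_mul_right h1' hu0
    have hlogle : Real.log c ≤ C ^ 2 := by
      rw [← husq]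
      exact pow_le_pow_left₀ hu0.le hule 2
    have hcle : (c : ℝ) ≤ Real.exp (C ^ 2) := by
      rwa [Real.log_le_iff_le_exp (by positivity)] at hlogle
    linarith

end Literature.NumberTheory.DiophantineGeometry

end
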